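import Summits.Schanuel.Schanuel.Theorems.RootDecomp1KHyper39

/-!
# RootDecomp1KHyper — lens 6, generation 15 ADDENDA (ExpAnchorT v2 88910796… §1–§6 · PiAnchorT b5ead9a0… §7 · PiAnchorU ed654c66… §8–§9) — continuation (RootDecomp1KHyper40): §8a (ll. 3271–3401) the NESTERENKO-LATTICE cell `HasPiLatAnchor` mod Cor. 5.2 ONLY (`sb_three_of_piLatAnchor`, `sb_three_of_piIntAnchor'`, `sb_three_one_pi_any'`, `rank3SpanResidual_iff_unanchored₃'`, `hasPiLatAnchor_zπ`); §8b (ll. 3402–3484) the earlier engines and cells as one-line corollaries (`sb_three_of_measuredLatAnchor'`, `sb_three_of_{lat,expInt,expPair,expLat}Anchor'`-type, `rank3SpanResidual_iff_unanchored₃''`)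

(lens-6 g15 addenda: `ExpAnchorT.lean` v2 88910796… = parts 28–35, `PiAnchorT.lean` b5ead9a0… §7 = parts 36–37, `PiAnchorU.lean` ed654c66… §8–§9 (U ll. 2881–3654; A–I byte-identical to T up to the two lint fixes) = parts 38–41;
farm rc 0 · 0 sorry · axioms std; port by census-1 gen 14, CENSUS-REQUESTs STATUS L1561 / L1583 / L1616, critic PORT GO L1568 (e) / L1588 (e) / L1617 (e); import `RootDecomp1KHyper26` (+ the two Nesterenko Literature modules from part 36 on),
sub-namespace `…HyperCell.LatCell`; statements and proofs verbatim (docstrings added, generic one-liners privatised; lint fixes: L1588 (a)'s two in §7c and two unused simp args `Matrix.head_cons` in §8a); binders hLW / h52 / hNW BY NAME; `--supports stmt-Schanuel-33363` (residual of record n = 3 := UnanchoredResidual₃‴, critic L1617 (c)). Nothing here proves Schanuel; rung 0.)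
-/

noncomputable section

open Complex IntermediateField Polynomial

namespace Summit.Schanuel.Schanuel.Theorems.RootDecomp1KHyper

namespace HyperCell

namespace LatCell

variable {n : ℕ}
open Summit.Schanuel.Schanuel.Theorems.RootDecomp1KGeneric (HasHLPairInSpan Rank3SpanResidual
  mem_adjoin_of_mem_span cexp_mem_adjoin_of_mem_span)

/-! ### §8a  The NESTERENKO-LATTICE cell (mod Cor. 5.2 ONLY) -/

/-- **The Nesterenko-lattice cell**: `π ∈ span_ℤ(z)` together with a second point `W(e^{π}, π)` of
`ℤ[e^{π}, π]` in `span_ℤ(z)`, polynomially independent of `π` (`U W + V x₁ ≠ 0` for `(U, V) ≠ 0`).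
A property of the lattice `span_ℤ(z)` only. -/
def HasPiLatAnchor {N : ℕ} (z : Fin N → ℂ) : Prop :=
  (Real.pi : ℂ) ∈ Submodule.span ℤ (Set.range z) ∧
    ∃ W : MvPolynomial (Fin 2) ℤ,
      (∀ U V : ℤ, (U ≠ 0 ∨ V ≠ 0) →
        MvPolynomial.C U * W + MvPolynomial.C V * MvPolynomial.X 1 ≠ 0) ∧
      MvPolynomial.aeval θπ W ∈ Submodule.span ℤ (Set.range z)

/-- `HasPiLatAnchor` is monotone along inclusions of `ℤ`-spans (re-basing invariant, padding-monotone). -/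
theorem HasPiLatAnchor.mono {N N' : ℕ} {z : Fin N → ℂ} {z' : Fin N' → ℂ}
    (hle : Submodule.span ℤ (Set.range z) ≤ Submodule.span ℤ (Set.range z'))
    (h : HasPiLatAnchor z) : HasPiLatAnchor z' := by
  obtain ⟨hπ, W, hW, hm⟩ := h
  exact ⟨hle hπ, W, hW, hle hm⟩

/-- `HasPiLatAnchor` depends only on the `ℤ`-span of the tuple. -/
theorem hasPiLatAnchor_congr_span {N N' : ℕ} {z : Fin N → ℂ} {z' : Fin N' → ℂ}
    (heq : Submodule.span ℤ (Set.range z) = Submodule.span ℤ (Set.range z')) :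
    HasPiLatAnchor z ↔ HasPiLatAnchor z' :=
  ⟨HasPiLatAnchor.mono heq.le, HasPiLatAnchor.mono heq.ge⟩

/-- `N₁ ≠ 0` (a constant) is polynomially independent of `x₁`. -/
theorem C_indep_X_one {N₁ : ℤ} (hN₁ : N₁ ≠ 0) (U V : ℤ) (hUV : U ≠ 0 ∨ V ≠ 0) :
    MvPolynomial.C U * MvPolynomial.C N₁ +
      MvPolynomial.C V * (MvPolynomial.X 1 : MvPolynomial (Fin 2) ℤ) ≠ 0 := by
  intro h
  have e0 := congr_arg (MvPolynomial.eval (![0, 0] : Fin 2 → ℤ)) h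
  have e1 := congr_arg (MvPolynomial.eval (![0, 1] : Fin 2 → ℤ)) h
  simp only [map_add, map_mul, MvPolynomial.eval_C, MvPolynomial.eval_X, map_zero,
    Matrix.cons_val_one, Matrix.cons_val_zero, mul_zero, add_zero,
    mul_one] at e0 e1
  have hU : U = 0 := (mul_eq_zero.mp e0).resolve_right hN₁
  rw [hU, zero_mul, zero_add] at e1
  rcases hUV with h' | h'
  · exact h' hU
  · exact h' e1

/-- `N x₀` (`N ≠ 0`) is polynomially independent of `x₁`. -/
theorem CX_zero_indep_X_one {N : ℤ} (hN : N ≠ 0) (U V : ℤ) (hUV : U ≠ 0 ∨ V ≠ 0) :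
    MvPolynomial.C U * (MvPolynomial.C N * MvPolynomial.X 0) +
      MvPolynomial.C V * (MvPolynomial.X 1 : MvPolynomial (Fin 2) ℤ) ≠ 0 := by
  intro h
  have e0 := congr_arg (MvPolynomial.eval (![1, 0] : Fin 2 → ℤ)) h
  have e1 := congr_arg (MvPolynomial.eval (![0, 1] : Fin 2 → ℤ)) h
  simp only [map_add, map_mul, MvPolynomial.eval_C, MvPolynomial.eval_X, map_zero,
    Matrix.cons_val_one, Matrix.cons_val_zero, mul_zero, add_zero,
    mul_one, zero_add] at e0 e1
  have hU : U = 0 := (mul_eq_zero.mp e0).resolve_right hN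
  rcases hUV with h' | h'
  · exact h' hU
  · exact h' e1

/-- The §7 cell is a Nesterenko-lattice cell (`W = N₁`). -/
theorem HasPiIntAnchor.hasPiLatAnchor {N : ℕ} {z : Fin N → ℂ} (h : HasPiIntAnchor z) :
    HasPiLatAnchor z := by
  obtain ⟨N₁, hN₁, h₁, h₂⟩ := h
  refine ⟨h₂, MvPolynomial.C N₁, C_indep_X_one hN₁, ?_⟩
  simpa using h₁

/-- `span ∋ π, N e^{π}` (`N ≠ 0`) is a Nesterenko-lattice cell (`W = N x₀`). -/
theorem hasPiLatAnchor_of_pi_cexp_pi {N : ℕ} {z : Fin N → ℂ}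
    (hπ : (Real.pi : ℂ) ∈ Submodule.span ℤ (Set.range z)) {M : ℤ} (hM : M ≠ 0)
    (he : (M : ℂ) * cexp (Real.pi : ℂ) ∈ Submodule.span ℤ (Set.range z)) : HasPiLatAnchor z := by
  refine ⟨hπ, MvPolynomial.C M * MvPolynomial.X 0, CX_zero_indep_X_one hM, ?_⟩
  simpa using he

/-- **MAIN THEOREM OF §8 (mod LNM 1752 Ch. 3 Cor. 5.2 ONLY).**  A ℚ-free `HyperLinLiouville` triple
whose ℤ-span is a Nesterenko-lattice cell has Schanuel's bound `trdeg ℚ(z, e^z) ≥ 3`. -/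
theorem sb_three_of_piLatAnchor
    (h52 : Literature.Barriers.Schanuel.NesterenkoPhilippon2001_ch3_cor_5_2)
    {z : Fin 3 → ℂ} (hz : LinearIndependent ℚ z) (hH : HyperLinLiouville z)
    (hA : HasPiLatAnchor z) : SB 3 z := by
  obtain ⟨hπ, W, hW, hm⟩ := hA
  have hθz : ∀ i, θπ i ∈ adjoin ℚ (SFset z ∪ {I}) := by
    intro i
    match i with
    | 0 => exact cexp_mem_adjoin_of_mem_span hπ
    | 1 => exact mem_adjoin_of_mem_span hπ
  exact sb_three_of_measuredLatAnchor hz hH (mvWeakMeasure_θπ h52) hθz W (MvPolynomial.X 1) hW hm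
    (by simpa using hπ)

/-- **The §7 cell mod Cor. 5.2 ONLY** (the `π`-measure binder `hNW` of `sb_three_of_piIntAnchor` is
not needed). -/
theorem sb_three_of_piIntAnchor'
    (h52 : Literature.Barriers.Schanuel.NesterenkoPhilippon2001_ch3_cor_5_2)
    {z : Fin 3 → ℂ} (hz : LinearIndependent ℚ z) (hH : HyperLinLiouville z)
    (hA : HasPiIntAnchor z) : SB 3 z :=
  sb_three_of_piLatAnchor h52 hz hH hA.hasPiLatAnchor

/-- **THE LITERAL M2 CELL `(1, π, y)`, ANY `y`, mod Cor. 5.2 ONLY.** -/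
theorem sb_three_one_pi_any'
    (h52 : Literature.Barriers.Schanuel.NesterenkoPhilippon2001_ch3_cor_5_2) {y : ℂ}
    (hz : LinearIndependent ℚ (latTriple 1 (Real.pi : ℂ) y))
    (hH : HyperLinLiouville (latTriple 1 (Real.pi : ℂ) y)) : SB 3 (latTriple 1 (Real.pi : ℂ) y) :=
  sb_three_of_piIntAnchor' h52 hz hH (hasPiIntAnchor_latTriple_one_pi y)

/-- **The cell `(π, N e^{π}, y)`-type: `span ∋ π, M e^{π}`, ANY third coordinate (mod Cor. 5.2 only).** -/
theorem sb_three_of_pi_cexp_pi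
    (h52 : Literature.Barriers.Schanuel.NesterenkoPhilippon2001_ch3_cor_5_2)
    {z : Fin 3 → ℂ} (hz : LinearIndependent ℚ z) (hH : HyperLinLiouville z)
    (hπ : (Real.pi : ℂ) ∈ Submodule.span ℤ (Set.range z)) {M : ℤ} (hM : M ≠ 0)
    (he : (M : ℂ) * cexp (Real.pi : ℂ) ∈ Submodule.span ℤ (Set.range z)) : SB 3 z :=
  sb_three_of_piLatAnchor h52 hz hH (hasPiLatAnchor_of_pi_cexp_pi hπ hM he)

/-- **The residual SPLIT along the Nesterenko-lattice cell (mod Cor. 5.2 only).** -/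
theorem rank3SpanResidual_iff_piLatUnanchored
    (h52 : Literature.Barriers.Schanuel.NesterenkoPhilippon2001_ch3_cor_5_2) :
    Rank3SpanResidual ↔
      ∀ z : Fin 3 → ℂ, LinearIndependent ℚ z → HyperLinLiouville z →
        ¬ HasHLPairInSpan z → ¬ HasPiLatAnchor z → SB 3 z :=
  rank3SpanResidual_iff_of_cell fun _ hz hH hA => sb_three_of_piLatAnchor h52 hz hH hA

/-- **THREE-CELL CARVE, final form (mod LW for the X/Q-cells, Cor. 5.2 for the P-cell; no `π`-measure).**
`Rank3SpanResidual` ⟺ the residual on triples that are neither quad-anchored, nor exp-lattice-anchored,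
nor Nesterenko-lattice-anchored. -/
theorem rank3SpanResidual_iff_unanchored₃' (hLW : LWMeasure)
    (h52 : Literature.Barriers.Schanuel.NesterenkoPhilippon2001_ch3_cor_5_2) :
    Rank3SpanResidual ↔
      ∀ z : Fin 3 → ℂ, LinearIndependent ℚ z → HyperLinLiouville z →
        ¬ HasHLPairInSpan z → ¬ HasRealQuadAnchor z → ¬ HasExpLatAnchor z → ¬ HasPiLatAnchor z →
          SB 3 z :=
  rank3SpanResidual_iff_of_cells₃ (fun _ hz hH hA => sb_three_of_realQuadAnchor hLW hz hH hA)
    (fun _ hz hH hA => sb_three_of_expLatAnchor hLW hz hH hA)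
    (fun _ hz hH hA => sb_three_of_piLatAnchor h52 hz hH hA)

/-- The member `z_π` lies in the Nesterenko-lattice cell (unconditional). -/
theorem hasPiLatAnchor_zπ : HasPiLatAnchor zπ := hasPiIntAnchor_zπ.hasPiLatAnchor

/-! ### §8b  The earlier engines and cells as ONE-LINE corollaries of the uniform theorem

`sb_three_of_latAnchor_of_uniform` has EXACTLY the signature of the §1 engine `sb_three_of_latAnchor`
(polynomial class `MvPolyMeasure`, e.g. every Lindemann–Weierstrass tuple via `mvPolyMeasure_exp_of_LW`);
the X-cells of §5 follow with their §5 proofs verbatim; the P-cells of §7/§8a are `sb_three_of_piLatAnchor`.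
So the uniform theorem carries the whole anchored programme of this file, with NO named fact in its
statement. -/

/-- The uniform theorem with the `w₁, w₂`-naming interface of §1. -/
theorem sb_three_of_measuredLatAnchor' {z : Fin 3 → ℂ} (hz : LinearIndependent ℚ z)
    (hH : HyperLinLiouville z) {θ : Fin 2 → ℂ} (hθ : MvWeakMeasure θ)
    (hθz : ∀ i, θ i ∈ adjoin ℚ (SFset z ∪ {I})) (W₁ W₂ : MvPolynomial (Fin 2) ℤ)
    (hW : ∀ U V : ℤ, (U ≠ 0 ∨ V ≠ 0) → MvPolynomial.C U * W₁ + MvPolynomial.C V * W₂ ≠ 0)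
    {w₁ w₂ : ℂ} (hw₁ : MvPolynomial.aeval θ W₁ = w₁) (hw₂ : MvPolynomial.aeval θ W₂ = w₂)
    (h₁ : w₁ ∈ Submodule.span ℤ (Set.range z)) (h₂ : w₂ ∈ Submodule.span ℤ (Set.range z)) :
    SB 3 z := by
  subst hw₁ hw₂
  exact sb_three_of_measuredLatAnchor hz hH hθ hθz W₁ W₂ hW h₁ h₂

/-- **The §1 engine (polynomial class) as a corollary** — same signature as `sb_three_of_latAnchor`. -/
private theorem sb_three_of_latAnchor_of_uniform {z : Fin 3 → ℂ} (hz : LinearIndependent ℚ z)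
    (hH : HyperLinLiouville z) {θ : Fin 2 → ℂ} (hθ : MvPolyMeasure θ)
    (hθz : ∀ i, θ i ∈ adjoin ℚ (SFset z ∪ {I})) (W₁ W₂ : MvPolynomial (Fin 2) ℤ)
    (hW : ∀ U V : ℤ, (U ≠ 0 ∨ V ≠ 0) → MvPolynomial.C U * W₁ + MvPolynomial.C V * W₂ ≠ 0)
    {w₁ w₂ : ℂ} (hw₁ : MvPolynomial.aeval θ W₁ = w₁) (hw₂ : MvPolynomial.aeval θ W₂ = w₂)
    (h₁ : w₁ ∈ Submodule.span ℤ (Set.range z)) (h₂ : w₂ ∈ Submodule.span ℤ (Set.range z)) :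
    SB 3 z :=
  sb_three_of_measuredLatAnchor' hz hH (MvPolyMeasure.mvWeakMeasure hθ) hθz W₁ W₂ hW hw₁ hw₂ h₁ h₂

/-- The X-cell with one exponential, through the uniform theorem (§5 proof verbatim). -/
theorem sb_three_of_expIntAnchor' (hLW : LWMeasure) {z : Fin 3 → ℂ} (hz : LinearIndependent ℚ z)
    (hH : HyperLinLiouville z) (hA : HasExpIntAnchor z) : SB 3 z := by
  obtain ⟨α, N₁, N₂, hα, hirr, hN₁, hN₂, hm₁, hm₂⟩ := hA
  set u : Fin 2 → ℂ := ![(N₁ : ℂ), α] with hu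
  have hua : ∀ i, IsAlgebraic ℚ (u i) := by
    intro i
    match i with
    | 0 => simpa [hu] using isAlgebraic_algebraMap (R := ℚ) (A := ℂ) (N₁ : ℚ)
    | 1 => simpa [hu] using hα
  have hli : LinearIndependent ℚ u := linearIndependent_int_irrat hirr hN₁
  have hθ := mvPolyMeasure_exp_of_LW hLW hua hli
  refine sb_three_of_latAnchor_of_uniform hz hH hθ ?_ (MvPolynomial.C N₁)
    (MvPolynomial.C N₂ * MvPolynomial.X 1) (indep_C_CX hN₁ hN₂) ?_ ?_ hm₁ hm₂
  · intro i
    match i with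
    | 0 => simpa [hu] using cexp_mem_adjoin_of_mem_span hm₁
    | 1 => simpa [hu] using mem_adjoin_of_int_mul_mem hN₂ (mem_adjoin_of_mem_span hm₂)
  · simp
  · simp [hu]

/-- The X-cell with two exponentials, through the uniform theorem (§5 proof verbatim). -/
theorem sb_three_of_expPairAnchor' (hLW : LWMeasure) {z : Fin 3 → ℂ} (hz : LinearIndependent ℚ z)
    (hH : HyperLinLiouville z) (hA : HasExpPairAnchor z) : SB 3 z := by
  obtain ⟨α, N₁, N₂, hα, hli, hN₁, hN₂, hm₁, hm₂⟩ := hA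
  have hθ := mvPolyMeasure_exp_of_LW hLW hα hli
  refine sb_three_of_latAnchor_of_uniform hz hH hθ ?_ (MvPolynomial.C N₁ * MvPolynomial.X 0)
    (MvPolynomial.C N₂ * MvPolynomial.X 1) (indep_CX_CX hN₁ hN₂) ?_ ?_ hm₁ hm₂
  · intro i
    match i with
    | 0 => exact mem_adjoin_of_int_mul_mem hN₁ (mem_adjoin_of_mem_span hm₁)
    | 1 => exact mem_adjoin_of_int_mul_mem hN₂ (mem_adjoin_of_mem_span hm₂)
  · simp
  · simp

/-- **The exponential-lattice-anchored cell through the uniform theorem** (only the LW MEASURE of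
`(e^{β₁}, e^{β₂})` enters, as `MvPolyMeasure`). -/
theorem sb_three_of_expLatAnchor' (hLW : LWMeasure) {z : Fin 3 → ℂ} (hz : LinearIndependent ℚ z)
    (hH : HyperLinLiouville z) (hA : HasExpLatAnchor z) : SB 3 z :=
  hA.elim (sb_three_of_expIntAnchor' hLW hz hH) (sb_three_of_expPairAnchor' hLW hz hH)

/-- **THREE-CELL CARVE through the uniform theorem alone** (X-cells and P-cell; the Q-cell keeps its
gen-15 engine). -/
theorem rank3SpanResidual_iff_unanchored₃'' (hLW : LWMeasure)
    (h52 : Literature.Barriers.Schanuel.NesterenkoPhilippon2001_ch3_cor_5_2) :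
    Rank3SpanResidual ↔
      ∀ z : Fin 3 → ℂ, LinearIndependent ℚ z → HyperLinLiouville z →
        ¬ HasHLPairInSpan z → ¬ HasRealQuadAnchor z → ¬ HasExpLatAnchor z → ¬ HasPiLatAnchor z →
          SB 3 z :=
  rank3SpanResidual_iff_of_cells₃ (fun _ hz hH hA => sb_three_of_realQuadAnchor hLW hz hH hA)
    (fun _ hz hH hA => sb_three_of_expLatAnchor' hLW hz hH hA)
    (fun _ hz hH hA => sb_three_of_piLatAnchor h52 hz hH hA)

end LatCell

end HyperCell

end Summit.Schanuel.Schanuel.Theorems.RootDecomp1KHyper
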